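import Summits.RiemannHypothesis.RiemannHypothesis.Theorems.OddSectorOddBartaFloorDefs
import Literature.NumberTheory.LFunctions.WeilWindowSuzukiProofs
import Literature.NumberTheory.LFunctions.WeilWindowSuzukiAsymptoticProofs
import Literature.NumberTheory.LFunctions.WeilMellinBounds
import Mathlib.MeasureTheory.Integral.Prod
import Mathlib.Analysis.Calculus.MeanValue
import HarnessLib

/-!
# The archimedean layer of the truncated odd tail: the Tonelli step
(crux OddBartaFloor, line Sketch, stub tailArchFubini)

For a window test `g` (`IsWeilTest g`, `tsupport g ⊆ [−a, a]`, `a ≤ b`), the truncated odd tail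
`R = R_{a,b} = oddThetaTailTrunc a b = H_b − H_a` (bounded, measurable, vanishing off
`a < |s| ≤ b`), `k = g ⋆ R̃ = weilConv g (weilReflect R)` (so that `k(r) = ∫ g(u) R(u − r) du`,
`R` being real) and `w = weilArchDensity`:

  `∫_{r>0} w(r) (k(r) + k(−r)) dr = ∫ g(u) A_{a,b}(u) du`,
  `A_{a,b}(u) = oddThetaArchLayerTrunc a b u = ∫ R(s) w(|u − s|) ds`,

and `g · A_{a,b}` is integrable. Proof: the kernel `F(u, r) = g(u) R(u − r) w(|r|)` is bounded on
`ℝ²` — where `g(u) R(u − r) ≠ 0` one has `|u| < a < |u − r|`, so `|r| > a − |u| > 0`, and `g`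
vanishes linearly at `±a` (mean value theorem, `‖g(u)‖ ≤ sup‖g′‖ · (a − |u|)`), which compensates
`w(|r|) ≤ e^{|r|/2}/(2|r|)` (`weilArchDensity_le_exp_half_div`) — and supported in a bounded box,
hence integrable on `ℝ²`. Fubini (`integral_integral_swap`), the substitution `s = u − r`
(`integral_sub_left_eq_self`) and the folding `∫_ℝ φ = ∫_{r>0} (φ(r) + φ(−r))` give the identity,
and `Integrable.integral_prod_left` the integrability. Elementary measure theory. [folklore]
-/

set_option linter.dupNamespace false

noncomputable section

open Set MeasureTheory Filter Complex
open scoped Real Topology ComplexConjugate ArithmeticFunction.vonMangoldt ENNReal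

namespace Summit.RiemannHypothesis.RiemannHypothesis.Theorems.OddBartaFloor

open Literature.NumberTheory.LFunctions

/-- The truncated tail lives on `a < |v| ≤ b`: `R_{a,b}(v) ≠ 0 → a < |v| ≤ b`. [folklore] -/
private theorem stub_tailArchFubini_ne_zero {a b v : ℝ} (hab : a ≤ b)
    (h : oddThetaTailTrunc a b v ≠ 0) : a < |v| ∧ |v| ≤ b := by
  rw [oddThetaTailTrunc_def] at h
  rcases le_or_gt |v| a with h1 | h1
  · rw [weilOddThetaVector_of_mem (mem_Icc.2 (abs_le.1 (h1.trans hab))),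
      weilOddThetaVector_of_mem (mem_Icc.2 (abs_le.1 h1)), sub_self] at h
    exact (h rfl).elim
  rcases le_or_gt |v| b with h2 | h2
  · exact ⟨h1, h2⟩
  rw [weilOddThetaVector_of_not_mem fun hv => h2.not_ge (abs_le.2 (mem_Icc.1 hv)),
    weilOddThetaVector_of_not_mem fun hv => h1.not_ge (abs_le.2 (mem_Icc.1 hv)),
    sub_self] at h
  exact (h rfl).elim

/-- The truncated tail is bounded. [folklore] -/
private theorem stub_tailArchFubini_bdd (a b : ℝ) :
    ∃ C : ℝ, 0 ≤ C ∧ ∀ v, |oddThetaTailTrunc a b v| ≤ C := by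
  obtain ⟨Ca, -, hCa⟩ := exists_abs_weilOddThetaVector_le a
  obtain ⟨Cb, hCb, hCb'⟩ := exists_abs_weilOddThetaVector_le b
  exact ⟨Cb + Ca, add_nonneg hCb ((abs_nonneg _).trans (hCa 0)), fun v =>
    (abs_sub _ _).trans (add_le_add (hCb' v) (hCa v))⟩

/-- A window test vanishes linearly at the edges of its window: `g(u) ≠ 0 → |u| < a` and
`‖g(u)‖ ≤ L (a − |u|)` with `L = sup ‖g′‖` (mean value theorem from `g(±a) = 0`). [folklore] -/
private theorem stub_tailArchFubini_edge {a : ℝ} {g : ℝ → ℂ} (hg : IsWeilTest g)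
    (hga : tsupport g ⊆ Icc (-a) a) :
    ∃ L : ℝ, 0 ≤ L ∧ ∀ u, g u ≠ 0 → |u| < a ∧ ‖g u‖ ≤ L * (a - |u|) := by
  obtain ⟨L, hL⟩ := hg.deriv.2.exists_bound_of_continuous hg.deriv.1.continuous
  have hd : Differentiable ℝ g := hg.1.differentiable (by simp)
  have hlip : ∀ x y, ‖g y - g x‖ ≤ L * ‖y - x‖ := fun x y =>
    convex_univ.norm_image_sub_le_of_norm_deriv_le (fun z _ => hd z) (fun z _ => hL z)
      (mem_univ x) (mem_univ y)
  have hsupp : Function.support g ⊆ Ioo (-a) a :=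
    (interior_maximal ((subset_tsupport g).trans hga) hg.1.continuous.isOpen_support).trans
      interior_Icc.subset
  have hz : ∀ c, c ∉ Ioo (-a) a → g c = 0 := fun c hc =>
    Function.notMem_support.1 fun h => hc (hsupp h)
  refine ⟨L, (norm_nonneg _).trans (hL 0), fun u hu => ?_⟩
  have hu' : u ∈ Ioo (-a) a := hsupp hu
  refine ⟨abs_lt.2 hu', ?_⟩
  rcases le_or_gt 0 u with h0 | h0
  · have := hlip a u
    rw [hz a fun h => lt_irrefl a h.2, sub_zero, Real.norm_eq_abs, abs_sub_comm,
      abs_of_nonneg (by linarith [hu'.2] : 0 ≤ a - u)] at this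
    rwa [abs_of_nonneg h0]
  · have := hlip (-a) u
    rw [hz (-a) fun h => lt_irrefl (-a) h.1, sub_zero, sub_neg_eq_add, Real.norm_eq_abs,
      abs_of_nonneg (by linarith [hu'.1] : 0 ≤ u + a)] at this
    rw [abs_of_neg h0]
    convert this using 2
    ring

/-- Folding an integrable `φ` onto the half-line: `∫_{r>0} (φ(r) + φ(−r)) dr = ∫ φ`. [folklore] -/
private theorem stub_tailArchFubini_fold {φ : ℝ → ℂ} (hφ : Integrable φ) :
    ∫ r in Ioi (0 : ℝ), (φ r + φ (-r)) = ∫ r, φ r := by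
  rw [integral_add hφ.integrableOn hφ.comp_neg.integrableOn, integral_comp_neg_Ioi, neg_zero,
    add_comm, intervalIntegral.integral_Iic_add_Ioi hφ.integrableOn hφ.integrableOn]

/-- The Tonelli kernel `F(u, r) = g(u) R(u − r) w(|r|)` is integrable on `ℝ²`: it is bounded (mean
value theorem for `g` at `±a` against `w(|r|) ≤ e^{|r|/2}/(2|r|)`) and vanishes off a bounded box.
[folklore] -/
private theorem stub_tailArchFubini_kernel {a b : ℝ} {g : ℝ → ℂ} (hab : a ≤ b)
    (hg : IsWeilTest g) (hga : tsupport g ⊆ Icc (-a) a) :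
    Integrable (fun p : ℝ × ℝ =>
      g p.1 * ((oddThetaTailTrunc a b (p.1 - p.2) * weilArchDensity |p.2| : ℝ) : ℂ))
      ((volume : Measure ℝ).prod volume) := by
  obtain ⟨L, hL0, hgL⟩ := stub_tailArchFubini_edge hg hga
  obtain ⟨C, hC0, hC⟩ := stub_tailArchFubini_bdd a b
  have hbox : MeasurableSet (Icc (-a) a ×ˢ Icc (-(a + b)) (a + b)) :=
    measurableSet_Icc.prod measurableSet_Icc
  have hR : Measurable (oddThetaTailTrunc a b) :=
    (measurable_weilOddThetaVector b).sub (measurable_weilOddThetaVector a)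
  refine Integrable.mono'
    (g := (Icc (-a) a ×ˢ Icc (-(a + b)) (a + b)).indicator fun _ =>
      L * Real.exp ((a + b) / 2) / 2 * C)
    ((integrable_indicator_iff hbox).2 (integrableOn_const ?_)) ?_ (ae_of_all _ fun p => ?_)
  · rw [Measure.prod_prod]
    exact ENNReal.mul_ne_top measure_Icc_lt_top.ne measure_Icc_lt_top.ne
  · exact ((hg.1.continuous.measurable.comp measurable_fst).mul
      (Complex.measurable_ofReal.comp ((hR.comp (measurable_fst.sub measurable_snd)).mul
        (measurable_weilArchDensity.comp (continuous_abs.measurable.comp measurable_snd))))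
      ).aestronglyMeasurable
  obtain ⟨u, r⟩ := p
  dsimp only
  by_cases h0 : g u = 0 ∨ oddThetaTailTrunc a b (u - r) = 0
  · have : g u * ((oddThetaTailTrunc a b (u - r) * weilArchDensity |r| : ℝ) : ℂ) = 0 := by
      rcases h0 with h | h <;> simp [h]
    rw [this, norm_zero]
    exact indicator_nonneg (fun _ _ => by positivity) _
  push Not at h0
  obtain ⟨hu, hgu⟩ := hgL u h0.1
  obtain ⟨hv, hvb⟩ := stub_tailArchFubini_ne_zero hab h0.2
  have h1 : a - |u| < |r| := by linarith [abs_sub u r]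
  have h2 : |r| ≤ a + b := by
    have := abs_sub u (u - r)
    rw [sub_sub_cancel] at this
    linarith
  have hr0 : 0 < |r| := by linarith [abs_nonneg u]
  have hr0' : |r| ≠ 0 := hr0.ne'
  rw [indicator_of_mem (mk_mem_prod (mem_Icc.2 (abs_le.1 hu.le)) (mem_Icc.2 (abs_le.1 h2)))]
  have hw0 : 0 < weilArchDensity |r| := weilArchDensity_pos hr0
  have hw : weilArchDensity |r| ≤ Real.exp ((a + b) / 2) / (2 * |r|) :=
    (weilArchDensity_le_exp_half_div hr0).trans (by gcongr)
  have key : ‖g u‖ * weilArchDensity |r| ≤ L * Real.exp ((a + b) / 2) / 2 :=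
    calc ‖g u‖ * weilArchDensity |r| ≤ L * |r| * (Real.exp ((a + b) / 2) / (2 * |r|)) :=
          mul_le_mul (hgu.trans (mul_le_mul_of_nonneg_left h1.le hL0)) hw hw0.le (by positivity)
      _ = L * Real.exp ((a + b) / 2) / 2 := by field_simp
  rw [norm_mul, norm_real, Real.norm_eq_abs, abs_mul, abs_of_pos hw0]
  calc ‖g u‖ * (|oddThetaTailTrunc a b (u - r)| * weilArchDensity |r|)
      = ‖g u‖ * weilArchDensity |r| * |oddThetaTailTrunc a b (u - r)| := by ring
    _ ≤ L * Real.exp ((a + b) / 2) / 2 * C := mul_le_mul key (hC _) (abs_nonneg _) (by positivity)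

/-- **The Tonelli step of the archimedean window computation.** For a window test `g`
(`tsupport g ⊆ [−a, a]`, `0 < a ≤ b`), the truncated odd tail `R = R_{a,b}` and `k = g ⋆ R̃`:
`∫_{r>0} w(r) (k(r) + k(−r)) dr = ∫ g(t) A_{a,b}(t) dt` with the archimedean layer
`A_{a,b}(t) = ∫ R(s) w(|t − s|) ds`, and `g · A_{a,b}` is integrable. [folklore] -/
theorem stub_tailArchFubini :
    ∀ (a b : ℝ) (g : ℝ → ℂ), 0 < a → a ≤ b → IsWeilTest g → tsupport g ⊆ Icc (-a) a →
      Integrable (fun t => g t * ((oddThetaArchLayerTrunc a b t : ℝ) : ℂ)) ∧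
      ∫ r in Ioi (0 : ℝ), (weilArchDensity r : ℂ) *
          (weilConv g (weilReflect fun t => ((oddThetaTailTrunc a b t : ℝ) : ℂ)) r +
            weilConv g (weilReflect fun t => ((oddThetaTailTrunc a b t : ℝ) : ℂ)) (-r)) =
        ∫ t, g t * ((oddThetaArchLayerTrunc a b t : ℝ) : ℂ) := by
  intro a b g _ hab hg hga
  set F : ℝ × ℝ → ℂ := fun p =>
    g p.1 * ((oddThetaTailTrunc a b (p.1 - p.2) * weilArchDensity |p.2| : ℝ) : ℂ) with hF
  have hFi : Integrable F ((volume : Measure ℝ).prod volume) := stub_tailArchFubini_kernel hab hg hga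
  have hpt : ∀ u, ∫ r, F (u, r) = g u * ((oddThetaArchLayerTrunc a b u : ℝ) : ℂ) := by
    intro u
    simp only [hF, integral_const_mul, integral_complex_ofReal, oddThetaArchLayerTrunc]
    rw [← integral_sub_left_eq_self
      (fun s => oddThetaTailTrunc a b s * weilArchDensity |u - s|) volume u]
    simp only [sub_sub_cancel]
  refine ⟨hFi.integral_prod_left.congr (Eventually.of_forall hpt), ?_⟩
  have hstep : ∀ r ∈ Ioi (0 : ℝ), (weilArchDensity r : ℂ) *
      (weilConv g (weilReflect fun t => ((oddThetaTailTrunc a b t : ℝ) : ℂ)) r +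
        weilConv g (weilReflect fun t => ((oddThetaTailTrunc a b t : ℝ) : ℂ)) (-r)) =
      (∫ t, F (t, r)) + ∫ t, F (t, -r) := by
    intro r hr
    have h1 : |r| = r := abs_of_pos hr
    simp only [hF, weilConv_apply, weilReflect, mul_add, ← integral_const_mul, conj_ofReal, abs_neg,
      h1, neg_sub, sub_neg_eq_add]
    congr 1 <;> refine integral_congr_ae (Eventually.of_forall fun u => ?_) <;> push_cast <;> ring
  rw [setIntegral_congr_fun measurableSet_Ioi hstep,
    stub_tailArchFubini_fold (φ := fun r => ∫ t, F (t, r)) hFi.integral_prod_right,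
    ← integral_integral_swap (f := fun t r => F (t, r)) hFi]
  exact integral_congr_ae (Eventually.of_forall hpt)

end Summit.RiemannHypothesis.RiemannHypothesis.Theorems.OddBartaFloor

end
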